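import Summits.CriticalPhenomena.PercolationContinuityZ3.Theorems.PercNearOneGluingNoHeavyPcintLoopExclusionSiteLaw
import HarnessLib

/-!
# CriticalPhenomena/PercolationContinuityZ3 — Theorems/PercNearOneGluingNoHeavyPcintLoopExclusionSitePolygons.lean: chordless neighbour-avoiding polygons exist at every even length `≥ 4` (`d ≥ 3`), so the typed site law C4-site is non-vacuous at every rung

Lane prim-pcint, STRUCTURE rule; companion of …PcintLoopExclusionSiteLaw (the SITE TWIN of C4, typed).  Its window clause
`siteLoopCompatWindow` asserts `0 < R^N_{2m}(d)` for every `d ≥ 3`, `m ≥ 2`; since `R^N = Δ^N/f^N` with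
`f^N_τ ∝ closingNawCount d τ = 2τ p^N_τ(ℤ^d)`, the clause would be vacuously FALSE (`x/0 = 0` in Lean) at any rung without a
chordless neighbour-avoiding polygon.  This file closes that gap: **`closingNawCount_even_pos` — `2τ p^N_τ(ℤ^d) > 0` for every
even `τ ≥ 4` and `d ≥ 3`** (unit square at `τ = 4` from the site-law file; the non-planar "chair" hexagon `e₀,e₁,e₂,−e₀,−e₁,−e₂`
at `τ = 6`, which needs `d ≥ 3` — there is no chordless hexagon in `ℤ²`, `p^N_6(ℤ²) = 0`; the `2 × b` rectangles at
`τ = 2b + 4 ≥ 8`), hence `siteLoopDensity_even_pos`.  Tools: explicit coordinates `P(t) = Σ_k Pi.single e_k (X_k t)` for the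
words, a unit step moves exactly one tracked coordinate by `±1` (`stepVec_two_coords`, `stepVec_three_coords`), and `omega` on
the piecewise-linear coordinates.  (The lane's engine counts: `p^N_4, p^N_6, p^N_8(ℤ³) = 3, 4, 27`.)

HONEST FRAMING: elementary combinatorics; a non-vacuity certificate for typed conjectures, nothing more.  Written by
prim-pcint-2 gen 16 (prover-prim-pcint-2-g16-0), 2026-08-24.
-/

noncomputable section

open Literature.Probability.LatticeModels Literature.Probability.Percolation
open Summit.CriticalPhenomena.PercolationContinuityZ3.Theorems.Pcint

namespace Summit.CriticalPhenomena.PercolationContinuityZ3.Theorems.Pcint.NawTail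

variable {d : ℕ}

/-- Reading a unit step off two tracked coordinates: if `P' = P + stepVec a` where `P`, `P'` are supported on the two
coordinates `e₀ ≠ e₁`, then exactly one tracked coordinate moves by `±1`. [folklore] -/
theorem stepVec_two_coords {e0 e1 : Fin d} (hne : e0 ≠ e1) {X Y X' Y' : ℤ} {a : Fin d × Bool}
    (h : (Pi.single e0 X' + Pi.single e1 Y' : Site d) = Pi.single e0 X + Pi.single e1 Y + stepVec a) :
    (X' = X + 1 ∧ Y' = Y) ∨ (X' = X - 1 ∧ Y' = Y) ∨ (X' = X ∧ Y' = Y + 1) ∨ (X' = X ∧ Y' = Y - 1) := by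
  obtain ⟨c, sgn⟩ := a
  have h0 := congrFun h e0
  have h1 := congrFun h e1
  have hc := congrFun h c
  by_cases hc0 : c = e0
  · subst hc0
    cases sgn <;> simp [stepVec, hne, hne.symm] at h0 h1 <;> omega
  · by_cases hc1 : c = e1
    · subst hc1
      cases sgn <;> simp [stepVec, hne, hne.symm] at h0 h1 <;> omega
    · cases sgn <;> simp [stepVec, hc0, hc1] at hc

/-- Two tracked coordinates determine equality. [folklore] -/
theorem two_coords_eq {e0 e1 : Fin d} (hne : e0 ≠ e1) {X Y X' Y' : ℤ}
    (h : (Pi.single e0 X' + Pi.single e1 Y' : Site d) = Pi.single e0 X + Pi.single e1 Y) : X' = X ∧ Y' = Y := by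
  have h0 := congrFun h e0
  have h1 := congrFun h e1
  simp [hne, hne.symm] at h0 h1
  exact ⟨h0, h1⟩

/-- **The `2 × b` rectangle (`b ≥ 2`) opened at its root is a chordless neighbour-avoiding polygon**: for `d ≥ 2` the
`(2b+3)`-step word `e₀², e₁^b, (−e₀)², (−e₁)^{b−1}` has neighbour-avoidance memory `2b+2` and ends at `e₁`, a neighbour of the
origin. [folklore] -/
theorem exists_closingNawWord_rect (hd : 2 ≤ d) {b n : ℕ} (hb : 2 ≤ b) (hn : n = 2 * b + 3) :
    ∃ w : Fin n → Fin d × Bool, IsNawMem (n - 1) w ∧ (zdGraph d).Adj 0 (wordPos w n) := by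
  subst hn
  obtain ⟨d', rfl⟩ : ∃ d', d = d' + 2 := ⟨d - 2, by omega⟩
  let e0 : Fin (d' + 2) := ⟨0, by omega⟩
  let e1 : Fin (d' + 2) := ⟨1, by omega⟩
  have hne : e0 ≠ e1 := by simp [e0, e1]
  let w : Fin (2 * b + 3) → Fin (d' + 2) × Bool := fun i =>
    if i.val < 2 then (e0, true) else if i.val ≤ b + 1 then (e1, true) else if i.val ≤ b + 3 then (e0, false) else (e1, false)
  let X : ℕ → ℤ := fun t => if t ≤ 2 then (t : ℤ) else if t ≤ b + 2 then 2 else if t = b + 3 then 1 else 0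
  let Y : ℕ → ℤ := fun t => if t ≤ 2 then 0 else if t ≤ b + 2 then (t : ℤ) - 2 else if t ≤ b + 4 then (b : ℤ) else 2 * (b : ℤ) + 4 - t
  let P : ℕ → Site (d' + 2) := fun t => Pi.single e0 (X t) + Pi.single e1 (Y t)
  have hP : ∀ t, t ≤ 2 * b + 3 → wordPos w t = P t := by
    intro t
    induction t with
    | zero => intro _; simp [P, X, Y]
    | succ t ih =>
      intro ht
      rw [wordPos_succ w (by omega : t < 2 * b + 3), ih (by omega)]
      rcases Nat.lt_or_ge t 2 with h0 | h0
      · have hw : w ⟨t, by omega⟩ = (e0, true) := by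
          simp only [w]; rw [if_pos h0]
        have hX : X (t + 1) = X t + 1 := by simp only [X]; split_ifs <;> first | contradiction | omega
        have hY : Y (t + 1) = Y t := by simp only [Y]; split_ifs <;> first | contradiction | omega
        rw [hw]; simp only [P, stepVec, if_true, hX, hY, Pi.single_add]; abel
      rcases Nat.lt_or_ge t (b + 2) with h1 | h1
      · have hw : w ⟨t, by omega⟩ = (e1, true) := by
          simp only [w]; split_ifs <;> first | rfl | (exfalso; omega)
        have hX : X (t + 1) = X t := by simp only [X]; split_ifs <;> first | contradiction | omega
        have hY : Y (t + 1) = Y t + 1 := by simp only [Y]; split_ifs <;> first | contradiction | omega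
        rw [hw]; simp only [P, stepVec, if_true, hX, hY, Pi.single_add]; abel
      rcases Nat.lt_or_ge t (b + 4) with h2 | h2
      · have hw : w ⟨t, by omega⟩ = (e0, false) := by
          simp only [w]; split_ifs <;> first | rfl | (exfalso; omega)
        have hX : X (t + 1) = X t - 1 := by simp only [X]; split_ifs <;> first | contradiction | omega
        have hY : Y (t + 1) = Y t := by simp only [Y]; split_ifs <;> first | contradiction | omega
        rw [hw]; simp only [P, stepVec, hX, hY, Pi.single_sub]; simp; abel
      · have hw : w ⟨t, by omega⟩ = (e1, false) := by
          simp only [w]; split_ifs <;> first | rfl | (exfalso; omega)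
        have hX : X (t + 1) = X t := by simp only [X]; split_ifs <;> first | contradiction | omega
        have hY : Y (t + 1) = Y t - 1 := by simp only [Y]; split_ifs <;> first | contradiction | omega
        rw [hw]; simp only [P, stepVec, hX, hY, Pi.single_sub]; simp; abel
  refine ⟨w, fun i j hj hij hτ => ⟨fun heq => ?_, fun h2 hadj => ?_⟩, ?_⟩
  · -- distinct sites
    rw [hP i (by omega), hP j hj] at heq
    obtain ⟨hX, hY⟩ := two_coords_eq hne heq.symm
    simp only [X, Y] at hX hY
    split_ifs at hX hY <;> omega
  · -- no chords
    rw [hP i (by omega), hP j hj] at hadj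
    obtain ⟨a, ha⟩ := (zdGraph_adj_iff_stepVec _ _).1 hadj
    have hc := stepVec_two_coords hne ha
    simp only [X, Y] at hc
    split_ifs at hc <;> omega
  · -- the end `e₁` is a neighbour of the origin
    rw [hP _ le_rfl]
    have hX : X (2 * b + 3) = 0 := by simp only [X]; split_ifs <;> first | contradiction | omega
    have hY : Y (2 * b + 3) = 1 := by simp only [Y]; split_ifs <;> first | contradiction | omega
    refine (zdGraph_adj_iff_stepVec _ _).2 ⟨(e1, true), ?_⟩
    simp [P, hX, hY, stepVec]


/-- Three tracked coordinates: a unit step moves exactly one of them by `±1`. [folklore] -/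
theorem stepVec_three_coords {e0 e1 e2 : Fin d} (h01 : e0 ≠ e1) (h02 : e0 ≠ e2) (h12 : e1 ≠ e2)
    {X Y Z X' Y' Z' : ℤ} {a : Fin d × Bool}
    (h : (Pi.single e0 X' + Pi.single e1 Y' + Pi.single e2 Z' : Site d) =
      Pi.single e0 X + Pi.single e1 Y + Pi.single e2 Z + stepVec a) :
    (X' = X + 1 ∧ Y' = Y ∧ Z' = Z) ∨ (X' = X - 1 ∧ Y' = Y ∧ Z' = Z) ∨ (X' = X ∧ Y' = Y + 1 ∧ Z' = Z) ∨
      (X' = X ∧ Y' = Y - 1 ∧ Z' = Z) ∨ (X' = X ∧ Y' = Y ∧ Z' = Z + 1) ∨ (X' = X ∧ Y' = Y ∧ Z' = Z - 1) := by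
  obtain ⟨c, sgn⟩ := a
  have h0 := congrFun h e0
  have h1 := congrFun h e1
  have h2 := congrFun h e2
  have hc := congrFun h c
  by_cases hc0 : c = e0
  · subst hc0
    cases sgn <;> simp [stepVec, h01, h02, h12, h01.symm, h02.symm, h12.symm] at h0 h1 h2 <;> omega
  by_cases hc1 : c = e1
  · subst hc1
    cases sgn <;> simp [stepVec, h01, h02, h12, h01.symm, h02.symm, h12.symm] at h0 h1 h2 <;> omega
  by_cases hc2 : c = e2
  · subst hc2
    cases sgn <;> simp [stepVec, h01, h02, h12, h01.symm, h02.symm, h12.symm] at h0 h1 h2 <;> omega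
  cases sgn <;> simp [stepVec, hc0, hc1, hc2] at hc

/-- Three tracked coordinates determine equality. [folklore] -/
theorem three_coords_eq {e0 e1 e2 : Fin d} (h01 : e0 ≠ e1) (h02 : e0 ≠ e2) (h12 : e1 ≠ e2)
    {X Y Z X' Y' Z' : ℤ}
    (h : (Pi.single e0 X' + Pi.single e1 Y' + Pi.single e2 Z' : Site d) = Pi.single e0 X + Pi.single e1 Y + Pi.single e2 Z) :
    X' = X ∧ Y' = Y ∧ Z' = Z := by
  have h0 := congrFun h e0
  have h1 := congrFun h e1
  have h2 := congrFun h e2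
  simp [h01, h02, h12, h01.symm, h02.symm, h12.symm] at h0 h1 h2
  exact ⟨h0, h1, h2⟩

/-- **The "chair" hexagon** `e₀, e₁, e₂, −e₀, −e₁, (−e₂)` of `ℤ^d`, `d ≥ 3`, opened at its root, is a chordless
neighbour-avoiding polygon of length `6`: the 5-step word has neighbour-avoidance memory `4` and ends at `e₂`. [folklore] -/
theorem exists_closingNawWord_six (hd : 3 ≤ d) :
    ∃ w : Fin 5 → Fin d × Bool, IsNawMem 4 w ∧ (zdGraph d).Adj 0 (wordPos w 5) := by
  obtain ⟨d', rfl⟩ : ∃ d', d = d' + 3 := ⟨d - 3, by omega⟩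
  let e0 : Fin (d' + 3) := ⟨0, by omega⟩
  let e1 : Fin (d' + 3) := ⟨1, by omega⟩
  let e2 : Fin (d' + 3) := ⟨2, by omega⟩
  have h01 : e0 ≠ e1 := by simp [e0, e1]
  have h02 : e0 ≠ e2 := by simp [e0, e2]
  have h12 : e1 ≠ e2 := by simp [e1, e2]
  let w : Fin 5 → Fin (d' + 3) × Bool := fun i =>
    if i.val = 0 then (e0, true) else if i.val = 1 then (e1, true) else if i.val = 2 then (e2, true)
    else if i.val = 3 then (e0, false) else (e1, false)
  let X : ℕ → ℤ := fun t => if t = 0 then 0 else if t ≤ 3 then 1 else 0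
  let Y : ℕ → ℤ := fun t => if t ≤ 1 then 0 else if t ≤ 4 then 1 else 0
  let Z : ℕ → ℤ := fun t => if t ≤ 2 then 0 else 1
  let P : ℕ → Site (d' + 3) := fun t => Pi.single e0 (X t) + Pi.single e1 (Y t) + Pi.single e2 (Z t)
  have hP : ∀ t, t ≤ 5 → wordPos w t = P t := by
    intro t
    induction t with
    | zero => intro _; simp [P, X, Y, Z]
    | succ t ih =>
      intro ht
      rw [wordPos_succ w (by omega : t < 5), ih (by omega)]
      have ht4 : t ≤ 4 := by omega
      interval_cases t
      all_goals simp [w, P, X, Y, Z, stepVec]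
      abel
  refine ⟨w, fun i j hj hij hτ => ⟨fun heq => ?_, fun h2 hadj => ?_⟩, ?_⟩
  · rw [hP i (by omega), hP j hj] at heq
    obtain ⟨hX, hY, hZ⟩ := three_coords_eq h01 h02 h12 heq.symm
    simp only [X, Y, Z] at hX hY hZ
    split_ifs at hX hY hZ <;> omega
  · rw [hP i (by omega), hP j hj] at hadj
    obtain ⟨a, ha⟩ := (zdGraph_adj_iff_stepVec _ _).1 hadj
    have hc := stepVec_three_coords h01 h02 h12 ha
    simp only [X, Y, Z] at hc
    split_ifs at hc <;> omega
  · rw [hP _ le_rfl]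
    refine (zdGraph_adj_iff_stepVec _ _).2 ⟨(e2, true), ?_⟩
    simp [P, X, Y, Z, stepVec]


/-- **`2τ p^N_τ(ℤ^d) > 0` for every even `τ = 2m ≥ 4` and `d ≥ 3`**: the unit square (`m = 2`), the chair hexagon (`m = 3`)
and the `2 × (m−2)` rectangles (`m ≥ 4`) are chordless neighbour-avoiding polygons; so `f^N_{2m}(d) > 0` at every rung of the
typed site law. [folklore] -/
theorem closingNawCount_even_pos (hd : 3 ≤ d) {m : ℕ} (hm : 2 ≤ m) : 0 < closingNawCount d (2 * m) := by
  classical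
  rcases (by omega : m = 2 ∨ m = 3 ∨ 4 ≤ m) with rfl | rfl | h4
  · exact closingNawCount_four_pos (by omega)
  · obtain ⟨w, h1, h2⟩ := exists_closingNawWord_six hd
    unfold closingNawCount
    refine Finset.card_pos.2 ⟨w, ?_⟩
    show w ∈ (nawMemWords d 4 5).filter fun w => (zdGraph d).Adj 0 (wordPos w 5)
    rw [Finset.mem_filter, mem_nawMemWords]
    exact ⟨h1, h2⟩
  · obtain ⟨w, h1, h2⟩ :=
      exists_closingNawWord_rect (d := d) (by omega) (b := m - 2) (n := 2 * m - 1) (by omega) (by omega)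
    unfold closingNawCount
    refine Finset.card_pos.2 ⟨w, ?_⟩
    rw [Finset.mem_filter, mem_nawMemWords]
    rw [show 2 * m - 1 - 1 = 2 * m - 2 by omega] at h1
    exact ⟨h1, h2⟩

/-- **`f^N_{2m}(d) > 0`** for `d ≥ 3`, `m ≥ 2`: the site window clause is not vacuously false at any rung. [folklore] -/
theorem siteLoopDensity_even_pos (hd : 3 ≤ d) {m : ℕ} (hm : 2 ≤ m) : 0 < siteLoopDensity d (2 * m) := by
  haveI : NeZero d := ⟨by omega⟩
  exact siteLoopDensity_pos (closingNawCount_even_pos hd hm)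

end Summit.CriticalPhenomena.PercolationContinuityZ3.Theorems.Pcint.NawTail
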